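import Summits.HodgeConjecture.HodgeConjecture.Theorems.FormalLiftingFromClassLifting.Negative.OneStepClassLift

/-!
# `FormalLiftingFromClassLifting` (stmt-HodgeConjecture-13825) · Negative · obstruction-tower decoration

Standing disprover, cycle 4 (refuter-cdisprove-stmt-HodgeConjecture-13825-g4-0, 2026-08-16): the
cycle-3 pre-warning (P) of `Cruxes/FormalLiftingFromClassLifting/Disproof.lean` as a theorem ((T5)
there). The lead's cycle-1 reduction `pSaturated_of_obstructionTower` (Lines/pro-class-correction-
syntomic.lean §7) derives stub S2 (`PSaturated 𝒳`) from an obstruction tower `(G m, ob m, t m)` —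
boundaries `ob m : K₀(X_k) → G m` vanishing exactly on `im(K₀(X_{m+1}) → K₀(X_k))`, compatible
transitions — TOGETHER WITH the `p`-torsion-freeness of its compatible families, and recommends filing
the missing relative-`K`-theory carrier as a hypothesis structure. This file shows that the
torsion-freeness clause can NOT be moved into a statement quantified over all such towers:

* `obstructionTower_schema_refuted`: for any group `K` and any antitone family of subgroups `im m`
  there is a tower satisfying the two axioms whose compatible families have `p`-torsion (the cokernel
  tower `K ⧸ im m` decorated by a constant summand `ℤ/p`);
* `obstructionTower_decoration`: in particular on the `K₀`-tower of EVERY `𝒳/W(k)`, with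
  `ob m y = 0 ↔ (y lifts to level m)` verbatim as in the lead's lemma.

So "every obstruction tower over `𝒳` is `p`-torsion-free on compatible families" is false on the first
`𝒳` satisfying the hypotheses of the crux; the typed residual of S2 must be pinned to the GENUINE tower
`G m = π₋₁K(X_{m+1}, X_k)` (once constructible) or stay in hypothesis position.
-/

set_option linter.dupNamespace false

namespace Summit.HodgeConjecture.HodgeConjecture.Theorems.FormalLiftingFromClassLifting.Negative

open CategoryTheory AlgebraicGeometry Limits
open Literature.AlgebraicGeometry Literature.AlgebraicGeometry.Motives
open Literature.AlgebraicGeometry.Motives.WittScheme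
open Summit.HodgeConjecture.HodgeConjecture.Theses.PadicSemiregularLift

noncomputable section

universe u

/-- **The torsion-freeness of the pro-obstruction group is not an axiom schema**: for any group `K`
and any antitone family of subgroups `im m` there is a tower `(G m, ob m, t m)` with
`t m ∘ ob (m+1) = ob m` and `ob m y = 0 ↔ y ∈ im m` admitting a compatible family killed by `p` and
non-zero at level `0` — namely `G m = (K ⧸ im m) × ℤ/p`, `ob m = (mk, 0)`, `t m = (can, id)`,
`g m = (0, 1)`. [folklore] -/
theorem obstructionTower_schema_refuted (p : ℕ) [Fact p.Prime] {K : Type u} [AddCommGroup K]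
    (im : ℕ → AddSubgroup K) (him : ∀ m, im (m + 1) ≤ im m) :
    ∃ (G : ℕ → Type u) (_ : ∀ m, AddCommGroup (G m)) (ob : ∀ m, K →+ G m)
      (t : ∀ m, G (m + 1) →+ G m),
      (∀ m y, t m (ob (m + 1) y) = ob m y) ∧ (∀ m y, ob m y = 0 ↔ y ∈ im m) ∧
      ∃ g : ∀ m, G m, (∀ m, t m (g (m + 1)) = g m) ∧ (∀ m, (p : ℤ) • g m = 0) ∧ g 0 ≠ 0 := by
  refine ⟨fun m => (K ⧸ im m) × ZMod p, fun m => inferInstance,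
    fun m => (QuotientAddGroup.mk' (im m)).prod 0,
    fun m => AddMonoidHom.prodMap
      (QuotientAddGroup.map (im (m + 1)) (im m) (AddMonoidHom.id K)
        (by rw [AddSubgroup.comap_id]; exact him m))
      (AddMonoidHom.id _),
    ?_, ?_, fun _ => (0, 1), ?_, ?_, ?_⟩
  · intro m y
    rfl
  · intro m y
    change ((y : K ⧸ im m), (0 : ZMod p)) = 0 ↔ y ∈ im m
    rw [Prod.mk_eq_zero, QuotientAddGroup.eq_zero_iff]
    exact and_iff_left rfl
  · intro m
    refine Prod.ext ?_ rfl
    change QuotientAddGroup.map (im (m + 1)) (im m) (AddMonoidHom.id K)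
        (by rw [AddSubgroup.comap_id]; exact him m) 0 = 0
    exact map_zero _
  · intro m
    refine Prod.ext ?_ ?_
    · change (p : ℤ) • (0 : K ⧸ im m) = 0
      exact smul_zero _
    · change (p : ℤ) • (1 : ZMod p) = 0
      rw [zsmul_eq_mul, mul_one, Int.cast_natCast, ZMod.natCast_self]
  · intro h
    have h1 : (1 : ZMod p) = 0 := congrArg Prod.snd h
    exact one_ne_zero h1

variable {p : ℕ} [Fact p.Prime] {k : Type} [Field k] [CharP k p]

/-- **Decoration on the `K₀`-tower of any `𝒳/W(k)`**: a tower `(G, ob, t)` satisfying verbatim the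
hypotheses `ht`, `hexact` of the lead's `pSaturated_of_obstructionTower`
(`ob m y = 0 ↔ ∃ z, K₀(X_k ⟶ X_{m+1}) z = y`), with a compatible family killed by `p` and non-zero at
level `0`. No hypothesis on `𝒳`. [folklore] -/
theorem obstructionTower_decoration (𝒳 : SchemeOver (WittVector p k)) :
    ∃ (G : ℕ → Type 1) (_ : ∀ m, AddCommGroup (G m))
      (ob : ∀ m, KTheory.KZero (specialFibre 𝒳).left →+ G m) (t : ∀ m, G (m + 1) →+ G m),
      (∀ m y, t m (ob (m + 1) y) = ob m y) ∧
      (∀ m y, ob m y = 0 ↔ ∃ z : KTheory.KZero (thickening 𝒳 (m + 1)).left,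
        KTheory.KZero.map (specialFibreToThickening 𝒳 m) z = y) ∧
      ∃ g : ∀ m, G m, (∀ m, t m (g (m + 1)) = g m) ∧ (∀ m, (p : ℤ) • g m = 0) ∧ g 0 ≠ 0 := by
  have him : ∀ m, (KTheory.KZero.map (specialFibreToThickening 𝒳 (m + 1))).range ≤
      (KTheory.KZero.map (specialFibreToThickening 𝒳 m)).range := by
    rintro m y ⟨z, rfl⟩
    refine ⟨KTheory.KZero.map (thickeningMap 𝒳 (Nat.le_succ (m + 1))) z, ?_⟩
    rw [← KTheory.KZero.map_comp_apply,
      specialFibreToThickening_comp_thickeningMap 𝒳 (Nat.le_succ (m + 1))]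
  obtain ⟨G, inst, ob, t, ht, hexact, g, hg, hpg, hg0⟩ :=
    obstructionTower_schema_refuted p
      (fun m => (KTheory.KZero.map (specialFibreToThickening 𝒳 m)).range) him
  refine ⟨G, inst, ob, t, ht, fun m y => ?_, g, hg, hpg, hg0⟩
  rw [hexact m y, AddMonoidHom.mem_range]

end

end Summit.HodgeConjecture.HodgeConjecture.Theorems.FormalLiftingFromClassLifting.Negative
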